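import Literature.MathematicalPhysics.QuantumFieldTheory.Balaban1983to89.T3AlphaInputsAC
import HarnessLib

/-!
# S1a · UV3-NODE §69.2 — THE (α)-SOCKET's ACTIVITY SYSTEM AT THE TRIVIAL HISTORY, FLATTENED TO `Fin n` IN `BalabanUVClass.Witness` SHAPE:
# locality, gauge invariance, per-domain size with print's weight, non-negativity of lengths∕weights, and THE SUM IDENTITY `Σ_X act X ∘ Umin = Pint(triv)`

Cell `ym3-torus` (YM ladder rung R3 = continuum `SU(2)` Yang–Mills on the three-torus — a RUNG: NOT d = 4, NOT infinite volume, NOT a mass gap, NOT Clay).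
Width seat «width 8» `ym3-torus-px8` (gen 22), FREE px helper on crux `stmt-QuantumFields-20520`, count-neutral, DEFINITION-FREE, default heartbeats; pen «(m2) door»
(px20 g20 09:06:17Z «GO — YOURS»): the β-INDEPENDENT, geometry-free half of the field map of UV3-NODE §69.2 — everything the door needs for the `Witness` fields
`nDom ∕ supp ∕ len ∕ wt ∕ act` and the clauses `act_local ∕ act_gaugeInvariant ∕ act_bound ∕ len_nonneg ∕ wt_nonneg`, plus the identity that turns `Σ_X act X (bg V)` into
print's interaction sum `Pint` of (43) — from the socket's schemas `IsLocal`, `GaugeInv26`, `TermSize`, `PintDecomp`, `AdmOnSmall` and `treeLen ≥ 0` (`LocCover.1`).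

WHAT (run `K`, level `k ≤ K`, trivial history `triv`; the domain index is the finite Σ-type `{(i, Y) : i ∈ [1, k], Y ∈ Loc K k triv i}` numbered by `Finset.equivFin`):
* §1 `domIdx` bookkeeping: `sum_domIdx_eq` — a sum over `Fin n` through the numbering equals the double sum `Σ_{i ∈ Icc 1 k} Σ_{Y ∈ Loc i}`;
* §2 ★★★ `activitySystem_of_alpha` — THE PACKAGE: `∃ (n : ℕ) (lvl : Fin n → ℕ) (dom : Fin n → Set Site) (supp : Fin n → Set PBond) (len wt : Fin n → ℝ) (act : Fin n → GaugeField → ℝ)` with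
  (a) `supp X = bondsIn 0 (enl (lvl X) (dom X))`, `len X = treeLen (lvl X) (dom X)`, `wt X = max C 0 · θBal(K−k+1)² · ((L^{k − lvl X})⁻¹)⁴`, `act X = Pterm (lvl X) (dom X)`, `1 ≤ lvl X ≤ k`,
  `dom X ∈ Loc K k triv (lvl X)`; (b) `act_local` ⟸ `IsLocal`; (c) `act_gaugeInvariant` ⟸ `GaugeInv26`; (d) `len_nonneg` ⟸ `LocCover.1`-shaped hypothesis; (e) `wt_nonneg`;
  (f) `act_bound` on the θ-window: `PlaqSmall θBal(K−k) W → |act X (Umin K k triv W)| ≤ wt X · exp(−κ₁ · len X)` ⟸ `TermSize` + `AdmOnSmall`; (g) THE SUM IDENTITY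
  `Σ_X act X (Umin K k triv W) = Pint K k triv W` ⟸ `PintDecomp` — i.e. `Witness.eff`'s activity sum IS (43)'s `Σ_jΣ_Y 𝒫_j(Y, U_k)` at the trivial history.

WHAT THIS FILE IS NOT (UV3-NODE §69.2∕§69.3): no `foot`∕`cover`∕`diam_foot` (they need the socket rows δ1 «domains are unions of big blocks» and δ4 «diam Y ≤ M₁Lⁱ(treeLen + 1)»,
untyped), no `isBackground` (δ2: the class file's one-clause competitor class vs print's two-clause space), no `lower`∕`upper` (δ7 a.e.→pointwise, δ8 `χ = 1` on the window,
and the β-CURRENCY mismatch of §69.3 awaiting the planners' ruling), no large-field clauses (δ9–δ10).  Nothing of Bałaban's is asserted or proved: the schemas are HYPOTHESES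
on a GIVEN `D : AlphaDataT3 F γ`; S1a(ᴴ), crux 20520 and `YM3TorusSU2` are NOT proved; no registered stub is closed; the Yang–Mills mass gap is NOT proved.

References: T. Bałaban, CMP **102** (1985) 255–275 [Balaban1985UV3] ((24)–(26) pp.262–263, (43)–(46) pp.266–267).
-/

set_option autoImplicit false

noncomputable section

namespace Summit.QuantumFields.YangMills.Theorems.FluctuationComparisonRegPrIntLS1aAlphaActivitySystem

open Finset
open scoped BigOperators
open Literature.MathematicalPhysics.QuantumFieldTheory.Balaban1983to89
open T3ContinuumYM3Torus T3UnitScaleTilt T3AlphaInputsAC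
open B10Eq42TorusConstraint (bondsIn)

variable {F : T3Family} {γ : ℝ}

/-! ## §1 The finite domain index at the trivial history and its numbering -/

/-- The level-tagged localisation domains of run `K`, level `k`, at the trivial history: the finite Σ-set `{⟨i, Y⟩ : i ∈ [1, k], Y ∈ Loc K k triv i}`.
[cite: Balaban1985UV3, (43) p.266] -/
theorem mem_domIdx_iff (D : AlphaDataT3 F γ) (K k : ℕ) (x : Σ _ : ℕ, Set (Site (F.P K) 0)) :
    x ∈ (Finset.Icc 1 k).sigma (fun i => D.Loc K k (D.triv K k) i) ↔ (1 ≤ x.1 ∧ x.1 ≤ k) ∧ x.2 ∈ D.Loc K k (D.triv K k) x.1 := by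
  simp [Finset.mem_sigma, Finset.mem_Icc]

/-- A sum over the numbering `Fin n ≃ domIdx` of a function of the tagged domain equals the double sum over levels and domains ((43)'s `Σ_{j=1}^k Σ_{Y_j}`).
[cite: Balaban1985UV3, (43) p.266] -/
theorem sum_equivFin_symm_eq {α : Type*} (s : Finset α) (f : α → ℝ) :
    ∑ X : Fin s.card, f ((s.equivFin.symm X : s) : α) = ∑ x ∈ s, f x := by
  rw [← Finset.sum_coe_sort s f]
  exact Equiv.sum_comp s.equivFin.symm (fun y : s => f (y : α))

/-! ## §2 The activity system in `Witness` shape -/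

/-- ★★★ **THE (α)-SOCKET's ACTIVITY SYSTEM AT THE TRIVIAL HISTORY, IN `BalabanUVClass.Witness` SHAPE** (run `K`, level `k ≤ K`): from the socket's schemas on a GIVEN datum `D` —
`IsLocal` (p.263), `GaugeInv26` ((26)), `TermSize` ((44), with `0 < κ₁`), `PintDecomp` ((43)), `AdmOnSmall` ((47) read on the datum) and `treeLen ≥ 0` ((24)) — a finite system of
`n` activities `act X = 𝒫_i(Y, ·)` numbered by `Fin n`, with supports `bondsIn 0 (enl Y)`, lengths `treeLen Y`, weights `max C 0 · θBal(K−k+1)² · L^{−4(k−i)}`, that is LOCAL,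
GAUGE-INVARIANT, obeys the printed per-domain SIZE at the composite minimiser of every `θBal(K−k)`-small datum, and SUMS to the interaction `Pint K k triv` of (41)∕(47) —
the `nDom ∕ supp ∕ len ∕ wt ∕ act` fields and the `act_*`∕`len_nonneg`∕`wt_nonneg` clauses of a class witness, plus `eff`'s activity sum.  (Footprints, `cover`, `diam_foot`,
`isBackground`, `lower`∕`upper`, large fields: NOT here — UV3-NODE §69.2.) [cite: Balaban1985UV3, (43)-(46) pp.266-267 and (26) p.263] -/
theorem activitySystem_of_alpha (D : AlphaDataT3 F γ) {b₀ p₀ C κ₁ : ℝ} (hloc : IsLocal D) (hgi : GaugeInv26 D) (hts : TermSize D b₀ p₀ C κ₁)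
    (hdec : PintDecomp D) (hadm : AdmOnSmall D b₀ p₀) (hlen : ∀ K i Y, 0 ≤ D.treeLen K i Y) (K k : ℕ) (hk : k ≤ K) :
    ∃ (n : ℕ) (lvl : Fin n → ℕ) (dom : Fin n → Set (Site (F.P K) 0)) (supp : Fin n → Set (PBond (F.P K) 0)) (len wt : Fin n → ℝ)
      (act : Fin n → GaugeField (F.P K) 0 (Matrix.specialUnitaryGroup (Fin 2) ℂ) → ℝ),
      (∀ X, 1 ≤ lvl X ∧ lvl X ≤ k ∧ dom X ∈ D.Loc K k (D.triv K k) (lvl X)) ∧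
      (∀ X, supp X = bondsIn 0 (D.enl K (lvl X) (dom X)) ∧ len X = D.treeLen K (lvl X) (dom X) ∧ act X = D.Pterm K (lvl X) (dom X) ∧
        wt X = max C 0 * θBal F.L γ b₀ p₀ (K - k + 1) ^ 2 * (((F.L : ℝ) ^ (k - lvl X))⁻¹) ^ 4) ∧
      (∀ X (U U' : GaugeField (F.P K) 0 (Matrix.specialUnitaryGroup (Fin 2) ℂ)), (∀ b ∈ supp X, U b = U' b) → act X U = act X U') ∧
      (∀ X, GaugeField.GaugeInvariant (act X)) ∧
      (∀ X, 0 ≤ len X) ∧ (∀ X, 0 ≤ wt X) ∧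
      (∀ X (W : GaugeField (F.P K) k (Matrix.specialUnitaryGroup (Fin 2) ℂ)), PlaqSmall (θBal F.L γ b₀ p₀ (K - k)) W →
        |act X (D.Umin K k (D.triv K k) W)| ≤ wt X * Real.exp (-(κ₁ * len X))) ∧
      (∀ W : GaugeField (F.P K) k (Matrix.specialUnitaryGroup (Fin 2) ℂ),
        ∑ X, act X (D.Umin K k (D.triv K k) W) = D.Pint K k (D.triv K k) W) := by
  classical
  set s : Finset (Σ _ : ℕ, Set (Site (F.P K) 0)) := (Finset.Icc 1 k).sigma (fun i => D.Loc K k (D.triv K k) i) with hs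
  set e := s.equivFin with he
  -- the tagged domain of an index
  set tag : Fin s.card → (Σ _ : ℕ, Set (Site (F.P K) 0)) := fun X => ((e.symm X : s) : Σ _ : ℕ, Set (Site (F.P K) 0)) with htag
  have htag_mem : ∀ X, tag X ∈ s := fun X => (e.symm X).2
  refine ⟨s.card, fun X => (tag X).1, fun X => (tag X).2, fun X => bondsIn 0 (D.enl K (tag X).1 (tag X).2), fun X => D.treeLen K (tag X).1 (tag X).2,
    fun X => max C 0 * θBal F.L γ b₀ p₀ (K - k + 1) ^ 2 * (((F.L : ℝ) ^ (k - (tag X).1))⁻¹) ^ 4, fun X => D.Pterm K (tag X).1 (tag X).2,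
    ?_, ?_, ?_, ?_, ?_, ?_, ?_, ?_⟩
  · intro X
    have h := (mem_domIdx_iff D K k (tag X)).mp (by rw [← hs]; exact htag_mem X)
    exact ⟨h.1.1, h.1.2, h.2⟩
  · intro X; exact ⟨rfl, rfl, rfl, rfl⟩
  · intro X U U' hUU'
    exact hloc K (tag X).1 (tag X).2 U U' fun b hb => hUU' b hb
  · intro X; exact hgi K (tag X).1 (tag X).2
  · intro X; exact hlen K (tag X).1 (tag X).2
  · intro X; positivity
  · intro X W hW
    have hmem := (mem_domIdx_iff D K k (tag X)).mp (by rw [← hs]; exact htag_mem X)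
    have hadm' : D.Adm K k (D.triv K k) W := hadm K k W hk hW
    have hsz := hts.2 K k (D.triv K k) W hk hadm' (tag X).1 hmem.1.1 hmem.1.2 (tag X).2 hmem.2
    refine hsz.trans ?_
    have hexp : 0 ≤ Real.exp (-κ₁ * D.treeLen K (tag X).1 (tag X).2) := Real.exp_nonneg _
    have hθ : 0 ≤ θBal F.L γ b₀ p₀ (K - k + 1) ^ 2 := sq_nonneg _
    have hL : 0 ≤ (((F.L : ℝ) ^ (k - (tag X).1))⁻¹) ^ 4 := by positivity
    calc C * Real.exp (-κ₁ * D.treeLen K (tag X).1 (tag X).2) * θBal F.L γ b₀ p₀ (K - k + 1) ^ 2 * (((F.L : ℝ) ^ (k - (tag X).1))⁻¹) ^ 4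
        ≤ max C 0 * Real.exp (-κ₁ * D.treeLen K (tag X).1 (tag X).2) * θBal F.L γ b₀ p₀ (K - k + 1) ^ 2 * (((F.L : ℝ) ^ (k - (tag X).1))⁻¹) ^ 4 := by
          gcongr; exact le_max_left C 0
      _ = max C 0 * θBal F.L γ b₀ p₀ (K - k + 1) ^ 2 * (((F.L : ℝ) ^ (k - (tag X).1))⁻¹) ^ 4 * Real.exp (-(κ₁ * D.treeLen K (tag X).1 (tag X).2)) := by
          rw [neg_mul]; ring
  · intro W
    rw [hdec K k (D.triv K k) W]
    have h1 : ∑ X : Fin s.card, D.Pterm K (tag X).1 (tag X).2 (D.Umin K k (D.triv K k) W) =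
        ∑ x ∈ s, D.Pterm K x.1 x.2 (D.Umin K k (D.triv K k) W) :=
      sum_equivFin_symm_eq s (fun x => D.Pterm K x.1 x.2 (D.Umin K k (D.triv K k) W))
    change ∑ X : Fin s.card, D.Pterm K (tag X).1 (tag X).2 (D.Umin K k (D.triv K k) W) = _
    rw [h1, hs, Finset.sum_sigma]

end Summit.QuantumFields.YangMills.Theorems.FluctuationComparisonRegPrIntLS1aAlphaActivitySystem

end
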